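import Literature.AlgebraicGeometry.Frobenioids.ArchimedeanFrobenioidStatements
import HarnessLib

/-!
# Frobenioids II, Example 3.3 (ii): "isotropic iff naively isotropic" — PROOF

Mochizuki, *The geometry of Frobenioids II: poly-Frobenioids*, Kyushu J. Math. **62** (2008)
401–460, §3, Example 3.3 (ii), author's text p. 28 [cite: MochizukiFrdII2008, Ex 3.3 (ii) p.28]:
"By Lemma 3.2, (i), it follows immediately that an object of `C` is isotropic [in the sense of
[Mzk5], Definition 1.2, (iv)] if and only if it is naively isotropic".

This file DISCHARGES the named statements `ArchFrd.Ex33ii_isotropic_iff π` and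
`ArchFrd.Ex33iii_isotropic_iff π` (`ArchimedeanFrobenioidStatements.lean`) for every base `π : D → D₀`:

* (⇐) if the angular region of `X` is isotropic, an isometric pre-step `X → B` of
  `C = C₀ ×_{D₀} D` has an invertible `D`-component (base-isomorphism), Frobenius degree `1` and
  `|c| · tip(A_X) = tip(A_B)` (isometry); its `C₀`-component is then inverted explicitly by the scalar
  `Base.act(c⁻¹)` (`C0.isIso_of_isIsotropic`), so it is an isomorphism of `C`;
* (⇒) if the angular region of `X` is not isotropic, the arrow `X → X^{iso}` onto the isotropic region
  of the same tip with the same base (`C0.toIsotropic`; scalar `1`, degree `1`) is an isometric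
  pre-step which is not an isomorphism (an inverse would force every direction of `S¹` into the
  angular part of `A_X`);
* (iii) "the isotropic objects of `A` are precisely the isotropic objects of `C`": arrows of `A` are
  isometric pre-steps of `A` iff their images are isometric pre-steps of `C`, and inverses of
  isometric isomorphisms of `C` are isometries (`ℝ_{≥0}` is sharp).
-/

namespace Literature.AlgebraicGeometry.Frobenioids

open CategoryTheory Opposite
open scoped Pointwise NNReal

noncomputable section

namespace ArchFrd

/-! ### `D₀`: twists of inverses -/

namespace D0

/-- The inverse of an isomorphism of `D₀` has the same twist (`conj⁻¹ = conj`).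
[cite: MochizukiFrdII2008, Def 3.1 (i) p.23] -/
theorem twists_inv {L K : D0} (b : L ⟶ K) [IsIso b] : Hom.twists (inv b) = Hom.twists b := by
  cases K with
  | real =>
    cases L with
    | real => rw [twists_of_real, twists_of_real]
    | complex => exact (isEmpty_hom_real_complex.false (inv b)).elim
  | complex =>
    have h := twists_comp_complex (inv b) b
    rw [IsIso.inv_hom_id, twists_id] at h
    revert h
    generalize Hom.twists (inv b) = s
    generalize Hom.twists b = t
    cases s <;> cases t <;> simp

/-- Twisting the inverse of a scalar of `L` along an isomorphism `L ⥲ K` gives a scalar of `K`.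
[cite: MochizukiFrdII2008, Def 3.1 (ii) p.23] -/
theorem act_inv_mem_scalars {L K : D0} (b : L ⟶ K) [IsIso b] {c : ℂˣ} (hc : c ∈ scalars L) :
    b.act c⁻¹ ∈ scalars K := by
  cases K with
  | complex => exact Subgroup.mem_top _
  | real =>
    cases L with
    | real =>
      change galAct (Hom.twists b) c⁻¹ ∈ scalars real
      rw [twists_of_real, galAct_false]
      exact inv_mem hc
    | complex => exact (isEmpty_hom_real_complex.false (inv b)).elim

end D0

namespace C0

variable {X Y : C0}

/-! ### (⇐) on `C₀`: inverting a linear isometric base-isomorphism out of an isotropic object -/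

/-- The inverse of a linear, isometric arrow `φ : X → Y` of `C₀` with invertible base out of a
naively isotropic `X`: `(Base(φ)⁻¹, 1, Base(φ).act(c⁻¹))`. [cite: MochizukiFrdII2008, Ex 3.3 (ii) p.28] -/
def invOfIsotropic (φ : X ⟶ Y) [IsIso (Base φ)] (hX : X.IsNaivelyIsotropic) (hdeg : degFr φ = 1)
    (hiso : ‖(scalar φ : ℂ)‖ * X.tip ^ (degFr φ : ℕ) = Y.tip) : Y ⟶ X where
  base := inv (Base φ)
  degFr := 1
  scalar := (Base φ).act (scalar φ)⁻¹
  scalar_mem := D0.act_inv_mem_scalars _ φ.scalar_mem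
  mapsTo := by
    rw [PNat.one_coe, pow_one]
    change _ ⊆ (inv (Base φ)).act '' X.region.carrier
    unfold D0.Hom.act
    rw [image_galAct_of_isIsotropic hX]
    rw [hdeg, PNat.one_coe, pow_one] at hiso
    have hc : 0 < ‖(scalar φ : ℂ)‖ := norm_pos_iff.mpr (scalar φ).ne_zero
    rintro _ ⟨u, hu, rfl⟩
    rw [mem_carrier_of_isIsotropic hX, ← Subtype.coe_le_coe, coe_absHom]
    change ‖((D0.galAct (D0.Hom.twists (Base φ)) (scalar φ)⁻¹ * u : ℂˣ) : ℂ)‖ ≤ X.tip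
    have hu' : ‖(u : ℂ)‖ ≤ Y.tip := by
      have := hu.2
      rw [← Subtype.coe_le_coe, coe_absHom] at this
      exact this
    rw [Units.val_mul, norm_mul, D0.norm_galAct, Units.val_inv_eq_inv_val, norm_inv]
    calc ‖(scalar φ : ℂ)‖⁻¹ * ‖(u : ℂ)‖ ≤ ‖(scalar φ : ℂ)‖⁻¹ * Y.tip := by
          gcongr
      _ = X.tip := by rw [← hiso, ← mul_assoc, inv_mul_cancel₀ hc.ne', one_mul]

/-- **(⇐) on `C₀`**: a linear isometric arrow with invertible base out of a naively isotropic object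
is an isomorphism. [cite: MochizukiFrdII2008, Ex 3.3 (ii) p.28] -/
theorem isIso_of_isIsotropic (φ : X ⟶ Y) [IsIso (Base φ)] (hX : X.IsNaivelyIsotropic)
    (hdeg : degFr φ = 1) (hiso : ‖(scalar φ : ℂ)‖ * X.tip ^ (degFr φ : ℕ) = Y.tip) : IsIso φ := by
  refine ⟨⟨invOfIsotropic φ hX hdeg hiso, ?_, ?_⟩⟩
  · refine hom_ext ?_ ?_ ?_
    · change Base φ ≫ inv (Base φ) = 𝟙 _
      exact IsIso.hom_inv_id _
    · change degFr φ * 1 = 1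
      rw [hdeg]; rfl
    · change (Base φ).act ((Base φ).act (scalar φ)⁻¹) * scalar φ ^ ((1 : ℕ+) : ℕ) = 1
      unfold D0.Hom.act
      rw [D0.galAct_galAct, PNat.one_coe, pow_one, inv_mul_cancel]
  · refine hom_ext ?_ ?_ ?_
    · change inv (Base φ) ≫ Base φ = 𝟙 _
      exact IsIso.inv_hom_id _
    · change 1 * degFr φ = 1
      rw [hdeg]; rfl
    · change (inv (Base φ)).act (scalar φ) * ((Base φ).act (scalar φ)⁻¹) ^ (degFr φ : ℕ) = 1
      unfold D0.Hom.act
      rw [D0.twists_inv, hdeg, PNat.one_coe, pow_one, ← map_mul, mul_inv_cancel, map_one]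

/-! ### (⇒) on `C₀`: the arrow onto the isotropic region of the same tip -/

/-- `X^{iso}`: the same base with the isotropic angular region of the same tip.
[cite: MochizukiFrdII2008, Ex 3.3 (ii) p.28] -/
def isotropify (X : C0) : C0 where
  base := X.base
  region := AngularRegion.isotropicOfTip X.region.tip
  isIsotropic_of_isReal _ := AngularRegion.isIsotropic_isotropicOfTip _

/-- `X^{iso}` is naively isotropic. [cite: MochizukiFrdII2008, Ex 3.3 (ii) p.28] -/
theorem isNaivelyIsotropic_isotropify (X : C0) : (isotropify X).IsNaivelyIsotropic :=
  AngularRegion.isIsotropic_isotropicOfTip _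

/-- The arrow `X → X^{iso}`: `(id, 1, 1)` (the angular region grows, the tip stays).
[cite: MochizukiFrdII2008, Ex 3.3 (ii) p.28] -/
def toIsotropic (X : C0) : X ⟶ isotropify X where
  base := 𝟙 X.base
  degFr := 1
  scalar := 1
  scalar_mem := one_mem _
  mapsTo := by
    rw [one_smul, PNat.one_coe, pow_one]
    change X.region.carrier ⊆ pullRegion (isotropify X) (𝟙 (isotropify X).base)
    rw [pullRegion_id]
    intro u hu
    rw [mem_carrier_of_isIsotropic (isNaivelyIsotropic_isotropify X)]
    exact hu.2

/-- `X → X^{iso}` has ratio `1` (it is an isometry). [cite: MochizukiFrdII2008, Ex 3.3 (ii) p.28] -/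
theorem ratio_toIsotropic (X : C0) : ratio (toIsotropic X) = 1 := by
  unfold ratio
  change (X.region.tip : ℝ) / (‖((1 : ℂˣ) : ℂ)‖ * X.tip ^ ((1 : ℕ+) : ℕ)) = 1
  rw [Units.val_one, norm_one, one_mul, PNat.one_coe, pow_one]
  exact div_self X.tip_pos.ne'

/-- If the isotropic region of tip `tip(A)` lies in `A`, then `A` is isotropic (every direction of `S¹`
occurs). [cite: MochizukiFrdII2008, Def 3.1 (iii) p.24] -/
theorem isIsotropic_of_isotropic_subset (A : AngularRegion ℂ)
    (h : (AngularRegion.isotropicOfTip A.tip : AngularRegion ℂ).carrier ⊆ A.carrier) :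
    A.IsIsotropic := by
  refine Set.eq_univ_of_forall fun z => ?_
  have key : unitPart ℂ ((z : ℂˣ) * ofPosReal ℂ A.tip) = z ∧
      absHom ℂ ((z : ℂˣ) * ofPosReal ℂ A.tip) = A.tip := by
    have e := Prod.ext_iff.mp ((unitDecomposition ℂ).symm_apply_apply (z, A.tip))
    exact ⟨e.1, e.2⟩
  have hmem : (z : ℂˣ) * ofPosReal ℂ A.tip ∈
      (AngularRegion.isotropicOfTip A.tip : AngularRegion ℂ).carrier := by
    rw [mem_carrier_of_isIsotropic (AngularRegion.isIsotropic_isotropicOfTip _)]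
    exact key.2.le
  have hA := h hmem
  rw [← key.1]
  exact hA.1

/-- **(⇒) on `C₀`**: if `A_X` is not isotropic then `X → X^{iso}` is not an isomorphism (an inverse
has base `id` and scalar `1`, forcing the isotropic region into `A_X`).
[cite: MochizukiFrdII2008, Ex 3.3 (ii) p.28] -/
theorem not_isIso_toIsotropic (X : C0) (hX : ¬ X.IsNaivelyIsotropic) : ¬ IsIso (toIsotropic X) := by
  intro h
  apply hX
  let g := inv (toIsotropic X)
  have hcomp : toIsotropic X ≫ g = 𝟙 X := IsIso.hom_inv_id _
  have hbase : Base g = 𝟙 X.base := by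
    have := congrArg Base hcomp
    rw [base_comp'] at this
    exact (Category.id_comp _).symm.trans this
  have hscalar : scalar g = 1 := by
    have := congrArg scalar hcomp
    rw [scalar_comp', scalar_id'] at this
    change D0.galAct (D0.Hom.twists (𝟙 X.base)) (scalar g) * 1 ^ (degFr g : ℕ) = 1 at this
    rwa [D0.twists_id, D0.galAct_false, one_pow, mul_one] at this
  have hdeg : degFr g = 1 := by
    have := congrArg degFr hcomp
    rw [degFr_comp', degFr_id'] at this
    change (1 : ℕ+) * degFr g = 1 at this
    rwa [one_mul] at this
  have htw : D0.Hom.twists (Base g) = false := by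
    rw [hbase]; exact D0.twists_id _
  have hmaps := g.mapsTo
  refine isIsotropic_of_isotropic_subset X.region fun u hu => ?_
  have hu' : scalar g • u ^ (degFr g : ℕ) ∈ pullRegion X (Base g) :=
    hmaps (Set.smul_mem_smul_set (Set.pow_mem_pow hu))
  unfold pullRegion D0.Hom.act at hu'
  rw [htw, D0.image_galAct_false, hscalar, one_smul, hdeg, PNat.one_coe, pow_one] at hu'
  exact hu'

end C0

/-! ### The claim for `C = C₀ ×_{D₀} D` -/

universe v u

variable {D : Type u} [Category.{v} D] (π : D ⥤ D0)

/-- The base `Base(φ₁)` of the `C₀`-component of a base-isomorphism of `C` is an isomorphism of `D₀`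
(it is `X.iso ≫ π(φ₂) ≫ Y.iso⁻¹`). [cite: MochizukiFrdII2008, Ex 3.3 (ii) p.28] -/
theorem C.isIso_base_fst {X Y : C π} (φ : X ⟶ Y) [IsIso φ.snd] : IsIso (C0.Base φ.fst) := by
  have h : (PreFrobenioid.baseFunctor C0.toElem).map φ.fst = (X.iso.hom ≫ π.map φ.snd) ≫ Y.iso.inv :=
    (Iso.eq_comp_inv Y.iso).mpr φ.w
  have h' : IsIso ((PreFrobenioid.baseFunctor C0.toElem).map φ.fst) := by
    rw [h]; infer_instance
  exact h'

/-- **Example 3.3 (ii)**: "an object of `C` is isotropic if and only if it is naively isotropic" —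
PROVED for every base `π : D → D₀`. [cite: MochizukiFrdII2008, Ex 3.3 (ii) p.28] -/
theorem Ex33ii_isotropic_iff_holds : Ex33ii_isotropic_iff π := by
  intro X
  constructor
  · -- (⇒): test against `X → X^{iso}`
    intro hC
    by_contra hX
    let X' : C π := ⟨C0.isotropify X.fst, X.snd, X.iso⟩
    let ψ : X ⟶ X' := ⟨C0.toIsotropic X.fst, 𝟙 X.snd, by
      change 𝟙 _ ≫ X.iso.hom = X.iso.hom ≫ π.map (𝟙 _)
      rw [Category.id_comp, CategoryTheory.Functor.map_id, Category.comp_id]⟩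
    have hψ : IsIso ψ := by
      refine hC ψ ?_ ⟨rfl, ?_⟩
      · change C0.div (C0.toIsotropic X.fst) = 1
        exact (A0.isIsometry_iff_ratio_eq_one _).mpr (C0.ratio_toIsotropic X.fst)
      · change IsIso (𝟙 X.snd)
        infer_instance
    haveI := hψ
    exact C0.not_isIso_toIsotropic X.fst hX (CFP.isIso_fst ψ)
  · -- (⇐): invert an isometric pre-step explicitly
    intro hX B ψ hisom hpre
    obtain ⟨hlin, hbase⟩ := hpre
    haveI : IsIso ψ.snd := hbase
    haveI : IsIso (C0.Base ψ.fst) := C.isIso_base_fst π ψ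
    have hdeg : C0.degFr ψ.fst = 1 := hlin
    have hiso' : C0.ratio ψ.fst = 1 := (A0.isIsometry_iff_ratio_eq_one _).mp hisom
    have hiso : ‖(C0.scalar ψ.fst : ℂ)‖ * X.fst.tip ^ (C0.degFr ψ.fst : ℕ) = B.fst.tip :=
      (A0.isIsometry_iff_norm_mul_tip_pow _).mp hisom
    haveI : IsIso ψ.fst := C0.isIso_of_isIsotropic ψ.fst hX hdeg hiso
    exact CFP.isIso_of_isIso_fst_snd ψ

/-- The inverse of an isomorphism of `C` which is an isometry is an isometry (`Φ = ℝ_{≥0}` is sharp).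
[cite: MochizukiFrdII2008, Ex 3.3 (iii) p.29] -/
theorem C.isIsometry_inv {X Y : C π} (f : X ⟶ Y) [IsIso f] :
    PreFrobenioid.IsIsometry (C.toElem π) (inv f) :=
  isSharp_nnreal.eq_one_of_isUnit _ (PreFrobenioid.isUnit_div_of_isIso (C.toElem π) (inv f))

/-- **Example 3.3 (iii)**: "the isotropic objects of `A` are precisely the isotropic objects of `C`" —
PROVED for every base `π : D → D₀` (an arrow of `A` is an isometric pre-step of `A` iff its image is
an isometric pre-step of `C`; isomorphisms of `C` between objects of `A` lie in `A`).
[cite: MochizukiFrdII2008, Ex 3.3 (iii) p.29] -/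
theorem Ex33iii_isotropic_iff_holds : Ex33iii_isotropic_iff π := by
  intro X
  constructor
  · intro hA B ψ hisom hpre
    let ψ' : X ⟶ (⟨B⟩ : A π) := ⟨ψ, hisom⟩
    have h1 : PreFrobenioid.IsIsometry (A.toElem π) ψ' := Subsingleton.elim _ _
    haveI : IsIso ψ' := hA ψ' h1 hpre
    exact (inferInstance : IsIso ((A.ι π).map ψ'))
  · intro hC B f _ hpre
    haveI : IsIso f.hom := hC f.hom f.property hpre
    refine ⟨⟨⟨inv f.hom, C.isIsometry_inv π f.hom⟩, ?_, ?_⟩⟩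
    · exact WideSubcategory.hom_ext _ (IsIso.hom_inv_id f.hom)
    · exact WideSubcategory.hom_ext _ (IsIso.inv_hom_id f.hom)

/-! ### Remark 3.3.1 for `C`, direction "injective on angular regions ⇒ monomorphism" -/

/-- Two arrows `W → X` of `C₀` with the same base, the same Frobenius degree and the same `d`-th power
of scalars coincide when `a ↦ c · a^d` is injective on `A_X` (evaluate both at a point of `A_W`).
[cite: MochizukiFrdII2008, Rmk 3.3.1 p.29] -/
theorem C0.scalar_eq_of_pow_eq {W X Y : C0} (g h : W ⟶ X) (φ : X ⟶ Y)
    (hinj : Set.InjOn (C0.regionMap φ) X.region.carrier) (hb : C0.Base g = C0.Base h)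
    (hd : C0.degFr g = C0.degFr h)
    (hs : C0.scalar g ^ (C0.degFr φ : ℕ) = C0.scalar h ^ (C0.degFr φ : ℕ)) :
    C0.scalar g = C0.scalar h := by
  obtain ⟨w, hw, -⟩ := C0.exists_mem_boundary W.region
  -- the two points of `A_X` hit by `w ^ d_g`
  obtain ⟨a₁, ha₁, e₁⟩ := g.mapsTo (Set.smul_mem_smul_set (Set.pow_mem_pow hw (n := (C0.degFr g : ℕ))))
  obtain ⟨a₂, ha₂, e₂⟩ := h.mapsTo (Set.smul_mem_smul_set (Set.pow_mem_pow hw (n := (C0.degFr h : ℕ))))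
  change (C0.Base g).act a₁ = C0.scalar g • w ^ (C0.degFr g : ℕ) at e₁
  change (C0.Base h).act a₂ = C0.scalar h • w ^ (C0.degFr h : ℕ) at e₂
  rw [← hb, ← hd] at e₂
  have ha₁' : a₁ = (C0.Base g).act (C0.scalar g * w ^ (C0.degFr g : ℕ)) := by
    rw [← smul_eq_mul, ← e₁]; exact (D0.galAct_galAct _ _).symm
  have ha₂' : a₂ = (C0.Base g).act (C0.scalar h * w ^ (C0.degFr g : ℕ)) := by
    rw [← smul_eq_mul, ← e₂]; exact (D0.galAct_galAct _ _).symm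
  have heq : C0.regionMap φ a₁ = C0.regionMap φ a₂ := by
    unfold C0.regionMap
    rw [ha₁', ha₂', ← map_pow, ← map_pow, mul_pow, mul_pow, hs]
  have h12 : a₁ = a₂ := hinj ha₁ ha₂ heq
  rw [ha₁', ha₂'] at h12
  exact mul_right_cancel ((C0.Base g).act.injective h12)

/-- **Remark 3.3.1** for `C`, direction (⇐): a base-isomorphism between complex objects which "induces
an injection on underlying angular regions" is a monomorphism — PROVED (the complex / base-isomorphism
hypotheses are not even needed for this direction beyond `Base(φ)` being an isomorphism).
[cite: MochizukiFrdII2008, Rmk 3.3.1 p.29] -/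
theorem Rmk331_C_mono_of_injOn {X Y : C π} (φ : X ⟶ Y)
    (hbase : PreFrobenioid.IsBaseIso (C.toElem π) φ)
    (hinj : Set.InjOn (C0.regionMap φ.fst) X.fst.region.carrier) : Mono φ := by
  haveI : IsIso φ.snd := hbase
  haveI : IsIso (C0.Base φ.fst) := C.isIso_base_fst π φ
  refine ⟨fun {W} g h e => ?_⟩
  have e₁ : g.fst ≫ φ.fst = h.fst ≫ φ.fst := congrArg CFP.Hom.fst e
  have e₂ : g.snd ≫ φ.snd = h.snd ≫ φ.snd := congrArg CFP.Hom.snd e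
  have hsnd : g.snd = h.snd := (cancel_mono φ.snd).mp e₂
  have hb : C0.Base g.fst = C0.Base h.fst :=
    (cancel_mono (C0.Base φ.fst)).mp (by
      have := congrArg C0.Base e₁
      rwa [C0.base_comp', C0.base_comp'] at this)
  have hd : C0.degFr g.fst = C0.degFr h.fst := by
    have := congrArg C0.degFr e₁
    rw [C0.degFr_comp', C0.degFr_comp'] at this
    exact mul_right_cancel this
  have hs : C0.scalar g.fst ^ (C0.degFr φ.fst : ℕ) = C0.scalar h.fst ^ (C0.degFr φ.fst : ℕ) := by
    have := congrArg C0.scalar e₁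
    rw [C0.scalar_comp', C0.scalar_comp', hb] at this
    exact mul_left_cancel this
  exact CFP.hom_ext (C0.hom_ext hb hd (C0.scalar_eq_of_pow_eq g.fst h.fst φ.fst hinj hb hd hs)) hsnd

end ArchFrd

end

end Literature.AlgebraicGeometry.Frobenioids
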